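import Summits.AtomisticToContinuum.Crystallization.Theorems.UniformPolytypeStability.Negative.SquashedLattice
import Summits.AtomisticToContinuum.Crystallization.Theorems.UniformPolytypeStability.Negative.WithoutHagg

/-!
# `UniformPolytypeStability` (stmt-AtomisticToContinuum-15800), negative side V″-b: the lower height bound is load-bearing

Part V″-b of the standing disprover's load-bearing analysis of crux `UniformPolytypeStability`
(route `DisclinationRation`).  On the crux's window with the LOWER height bound
`39a/50 ≤ z(m+1) − z(m)` deleted (keeping `0 < z(m+1) − z(m) ≤ 17a/20`, `47/50 ≤ a ≤ 1`,
`IsHaggSeq s`, force balance) uniform polytype stability FAILS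
(`uniformPolytypeStability_false_without_heightLower`): for the squashed fcc lattice of part V″-a
(`a₀ = 47/50`, `h = 1/10`) and `u = e₁·𝟙_{0}`, `½·hessForm = Σ'_n e₁ᵀK(YL n)e₁ < 0 ≤ κ·nnForm`.
This file: the far field — `|T| ≤ 8q⁻⁴ ≤` three slab majorants in sheared labels (`BL`, reusing
`w2`, `t4`, `hasSum_mul3` of parts III′/V′, summed with `ζ(2)`, `ζ(4)`, `π < 3.15`: `Σ BL ≤ 10⁶`
against the exact near field `< −4·10⁷`), absolute summability of the row, its transport to the
lattice, and the final theorem.  (The disprover's Bloch scan, Cruxes workfile part IV, shows the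
statement is false already at `h = 0.66a` through an EXTENDED shear mode; the single-site witness
needs `h ≲ 0.15`.)  All `[folklore]`.
-/

noncomputable section

namespace Summit.AtomisticToContinuum.Crystallization.Theorems.UniformPolytypeStabilityNegative

open scoped BigOperators Topology Classical InnerProductSpace
open Filter Set Function Real
open Literature.MathematicalPhysics.StatisticalMechanics
open Summit.AtomisticToContinuum.Crystallization.Theorems.PhononStabilityNegative

local notation "E3" => EuclideanSpace ℝ (Fin 3)

section HeightLower

/-- `q⁻¹ ≤ w_c(n)` when `q ≥ 1` and `q ≥ n²/c` (`c > 0`). [folklore] -/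
theorem inv_le_w2_of_le {q c : ℝ} {n : ℤ} (hc : 0 < c) (hq1 : 1 ≤ q) (hqn : c⁻¹ * (n : ℝ) ^ 2 ≤ q) :
    q⁻¹ ≤ w2 c n := by
  unfold w2
  split_ifs with hn
  · exact inv_le_one_of_one_le₀ hq1
  · have hn2 : (0 : ℝ) < (n : ℝ) ^ 2 := by positivity
    rw [show c * ((n : ℝ) ^ 2)⁻¹ = (c⁻¹ * (n : ℝ) ^ 2)⁻¹ by rw [mul_inv, inv_inv]]
    exact inv_anti₀ (by positivity) hqn

/-- In-plane weight constant of the sheared labels, `3/a₀²`. [folklore] -/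
def cL : ℝ := 3 / a₀ ^ 2

/-- `cL > 0` and `cL⁻¹ = a₀²/3`. [folklore] -/
theorem cL_pos_inv : 0 < cL ∧ cL⁻¹ = a₀ ^ 2 / 3 := by
  refine ⟨by unfold cL a₀; norm_num, by unfold cL; rw [inv_div]⟩

/-- The far-field majorant of the squashed lattice: `8·(i-slab + j-slab + m-slab)`. [folklore] -/
def BL (n : ℤ × ℤ × ℤ) : ℝ :=
  8 * (cL ^ 2 * (t4 n.1 * (w2 cL n.2.1 * w2 100 n.2.2)) +
    cL ^ 2 * (w2 cL n.1 * (t4 n.2.1 * w2 100 n.2.2)) +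
    100 ^ 2 * (w2 cL n.1 * (w2 cL n.2.1 * t4 n.2.2)))

/-- The three slab terms are `≥ 0`. [folklore] -/
theorem BL_parts_nonneg (n : ℤ × ℤ × ℤ) :
    0 ≤ cL ^ 2 * (t4 n.1 * (w2 cL n.2.1 * w2 100 n.2.2)) ∧
      0 ≤ cL ^ 2 * (w2 cL n.1 * (t4 n.2.1 * w2 100 n.2.2)) ∧
        0 ≤ (100 : ℝ) ^ 2 * (w2 cL n.1 * (w2 cL n.2.1 * t4 n.2.2)) := by
  have hA := w2_nonneg cL_pos_inv.1.le
  have hH := w2_nonneg (show (0 : ℝ) ≤ 100 by norm_num)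
  exact ⟨by have := t4_nonneg n.1; have := hA n.2.1; have := hH n.2.2; positivity,
    by have := t4_nonneg n.2.1; have := hA n.1; have := hH n.2.2; positivity,
    by have := t4_nonneg n.2.2; have := hA n.1; have := hA n.2.1; positivity⟩

/-- Outside the block `q⁻⁴` is dominated by the three slab terms. [folklore] -/
theorem inv_pow_four_le_slabsL {i j m : ℤ} (hout : 3 ≤ |i| ∨ 3 ≤ |j| ∨ 10 ≤ |m|) :
    ((‖YL (i, j, m)‖ ^ 2)⁻¹) ^ 4 ≤ cL ^ 2 * (t4 i * (w2 cL j * w2 100 m)) +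
      cL ^ 2 * (w2 cL i * (t4 j * w2 100 m)) + 100 ^ 2 * (w2 cL i * (w2 cL j * t4 m)) := by
  obtain ⟨hB1, hB2, hB3⟩ := BL_parts_nonneg (i, j, m)
  dsimp only at hB1 hB2 hB3
  obtain ⟨hqi, hqj, hqm, -, h1⟩ := slabL_bounds i j m
  have hq1 := h1 hout
  set q : ℝ := ‖YL (i, j, m)‖ ^ 2
  have hi0 : 0 ≤ q⁻¹ := inv_nonneg.2 (by linarith)
  have hcL := cL_pos_inv
  have hwA := w2_nonneg hcL.1.le
  have h100 : (0 : ℝ) < 100 := by norm_num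
  have e4 : (q⁻¹) ^ 4 = (q⁻¹) ^ 2 * (q⁻¹ * q⁻¹) := by ring
  rw [e4]
  have hqi' : cL⁻¹ * (i : ℝ) ^ 2 ≤ q := by rw [hcL.2]; exact hqi
  have hqj' : cL⁻¹ * (j : ℝ) ^ 2 ≤ q := by rw [hcL.2]; exact hqj
  rcases hout with hi | hj | hm
  · have h1 : (q⁻¹) ^ 2 ≤ cL ^ 2 * t4 i := inv_sq_le_t4 hcL.1 hi hqi'
    have h2 : q⁻¹ * q⁻¹ ≤ w2 cL j * w2 100 m :=
      mul_le_mul (inv_le_w2_of_le hcL.1 hq1 hqj') (inv_le_w2_of_le h100 hq1 hqm) hi0 (hwA j)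
    have h3 := mul_le_mul h1 h2 (by positivity) (by have := t4_nonneg i; positivity)
    calc (q⁻¹) ^ 2 * (q⁻¹ * q⁻¹) ≤ cL ^ 2 * t4 i * (w2 cL j * w2 100 m) := h3
      _ = cL ^ 2 * (t4 i * (w2 cL j * w2 100 m)) := by ring
      _ ≤ _ := by linarith
  · have h1 : (q⁻¹) ^ 2 ≤ cL ^ 2 * t4 j := inv_sq_le_t4 hcL.1 hj hqj'
    have h2 : q⁻¹ * q⁻¹ ≤ w2 cL i * w2 100 m :=
      mul_le_mul (inv_le_w2_of_le hcL.1 hq1 hqi') (inv_le_w2_of_le h100 hq1 hqm) hi0 (hwA i)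
    have h3 := mul_le_mul h1 h2 (by positivity) (by have := t4_nonneg j; positivity)
    calc (q⁻¹) ^ 2 * (q⁻¹ * q⁻¹) ≤ cL ^ 2 * t4 j * (w2 cL i * w2 100 m) := h3
      _ = cL ^ 2 * (w2 cL i * (t4 j * w2 100 m)) := by ring
      _ ≤ _ := by linarith
  · have hm3 : 3 ≤ |m| := le_trans (by norm_num) hm
    have h1 : (q⁻¹) ^ 2 ≤ 100 ^ 2 * t4 m := inv_sq_le_t4 h100 hm3 hqm
    have h2 : q⁻¹ * q⁻¹ ≤ w2 cL i * w2 cL j :=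
      mul_le_mul (inv_le_w2_of_le hcL.1 hq1 hqi') (inv_le_w2_of_le hcL.1 hq1 hqj') hi0 (hwA i)
    have h3 := mul_le_mul h1 h2 (by positivity) (by have := t4_nonneg m; positivity)
    calc (q⁻¹) ^ 2 * (q⁻¹ * q⁻¹) ≤ 100 ^ 2 * t4 m * (w2 cL i * w2 cL j) := h3
      _ = 100 ^ 2 * (w2 cL i * (w2 cL j * t4 m)) := by ring
      _ ≤ _ := by linarith

/-- **Far-field domination (two-sided):** `|TfarL| ≤ BL` termwise. [folklore] -/
theorem abs_TfarL_le_BL (n : ℤ × ℤ × ℤ) : |TfarL n| ≤ BL n := by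
  obtain ⟨i, j, m⟩ := n
  obtain ⟨hB1, hB2, hB3⟩ := BL_parts_nonneg (i, j, m)
  dsimp only at hB1 hB2 hB3
  show |TfarL (i, j, m)| ≤ 8 * (cL ^ 2 * (t4 i * (w2 cL j * w2 100 m)) +
      cL ^ 2 * (w2 cL i * (t4 j * w2 100 m)) + 100 ^ 2 * (w2 cL i * (w2 cL j * t4 m)))
  unfold TfarL
  by_cases h : ((i, j, m) : ℤ × ℤ × ℤ) = 0 ∨ ((i, j, m) : ℤ × ℤ × ℤ) ∈ blockL
  · rw [if_pos h, abs_zero]; linarith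
  rw [if_neg h]
  push Not at h
  obtain ⟨hn0, hnb⟩ := h
  have hout : 3 ≤ |i| ∨ 3 ≤ |j| ∨ 10 ≤ |m| := by
    by_contra hc
    push Not at hc
    obtain ⟨hi, hj, hm⟩ := hc
    rw [abs_lt] at hi hj hm
    apply hnb
    simp only [blockL, Finset.mem_erase, Finset.mem_product, Finset.mem_Icc]
    exact ⟨hn0, ⟨by omega, by omega⟩, ⟨by omega, by omega⟩, by omega, by omega⟩
  have hY : YL (i, j, m) ≠ 0 := YL_ne_zero hn0
  rw [hx, if_neg hY, Hess₀_ex₁_eq hY]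
  obtain ⟨-, -, -, ⟨hp0, hpq⟩, h1⟩ := slabL_bounds i j m
  have hq1 := h1 hout
  obtain ⟨hup, hlo⟩ := TQ_abs_bounds hp0 hpq hq1
  have hsl := inv_pow_four_le_slabsL hout
  have h4 : 0 ≤ ((‖YL (i, j, m)‖ ^ 2)⁻¹) ^ 4 := by positivity
  rw [abs_le]
  constructor <;> nlinarith

/-- The majorant is summable with an explicit sum. [folklore] -/
theorem hasSum_BL : HasSum BL
    (8 * (cL ^ 2 * ((∑' n, t4 n) * ((∑' n, w2 cL n) * ∑' n, w2 100 n)) +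
      cL ^ 2 * ((∑' n, w2 cL n) * ((∑' n, t4 n) * ∑' n, w2 100 n)) +
      100 ^ 2 * ((∑' n, w2 cL n) * ((∑' n, w2 cL n) * ∑' n, t4 n)))) := by
  have hA := summable_norm_w2 cL
  have hH := summable_norm_w2 100
  exact ((((hasSum_mul3 summable_norm_t4 hA hH).mul_left _).add
    ((hasSum_mul3 hA summable_norm_t4 hH).mul_left _)).add
    ((hasSum_mul3 hA hA summable_norm_t4).mul_left _)).mul_left 8

/-- **The far field is at most `10⁶`** (against a near field below `−4·10⁷`). [folklore] -/
theorem tsum_BL_le : ∑' n, BL n ≤ 1000000 := by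
  rw [hasSum_BL.tsum_eq]
  have hcL := cL_pos_inv
  have ht := tsum_t4_le
  have ht0 : 0 ≤ ∑' n, t4 n := tsum_nonneg t4_nonneg
  have hwA := tsum_w2_le hcL.1.le
  have hwH := tsum_w2_le (show (0 : ℝ) ≤ 100 by norm_num)
  have hwA0 : 0 ≤ ∑' n, w2 cL n := tsum_nonneg (w2_nonneg hcL.1.le)
  have hwH0 : 0 ≤ ∑' n, w2 100 n := tsum_nonneg (w2_nonneg (show (0 : ℝ) ≤ 100 by norm_num))
  have hc : cL ≤ 34 / 10 := by unfold cL a₀; norm_num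
  have hc0 := hcL.1.le
  set T := ∑' n, t4 n
  set WA := ∑' n, w2 cL n
  set WH := ∑' n, w2 (100 : ℝ) n
  have hWA : WA ≤ 123 / 10 := by nlinarith
  have hWH : WH ≤ 332 := by linarith
  have h1 : cL ^ 2 * (T * (WA * WH)) ≤ (34 / 10) ^ 2 * (63 / 1000 * (123 / 10 * 332)) := by
    gcongr
  have h2 : cL ^ 2 * (WA * (T * WH)) ≤ (34 / 10) ^ 2 * (123 / 10 * (63 / 1000 * 332)) := by
    gcongr
  have h3 : (100 : ℝ) ^ 2 * (WA * (WA * T)) ≤ 100 ^ 2 * (123 / 10 * (123 / 10 * (63 / 1000))) := by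
    gcongr
  linarith

/-! ### Summability of the row function and the sign of the second variation -/

/-- The far part is absolutely summable. [folklore] -/
theorem summable_TfarL : Summable TfarL :=
  Summable.of_norm_bounded hasSum_BL.summable fun n => by
    rw [Real.norm_eq_abs]; exact abs_TfarL_le_BL n

/-- The full row function of the squashed lattice is summable over the sheared labels. [folklore] -/
theorem summable_hx_YL : Summable fun n : ℤ × ℤ × ℤ => hx (YL n) := by
  obtain ⟨S, hS, -⟩ := hasSum_TnearL
  exact (hS.summable.add summable_TfarL).congr fun n => (hx_eq_addL n).symm

/-- **The second variation of `e₁·𝟙_{0}` on the squashed fcc lattice is negative:**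
`Σ'_n e₁ᵀK(YL n)e₁ < −4·10⁷ + 10⁶ < 0`. [folklore] -/
theorem tsum_hx_YL_neg : ∑' n : ℤ × ℤ × ℤ, hx (YL n) < 0 := by
  obtain ⟨S, hS, hSlt⟩ := hasSum_TnearL
  have hsplit : ∑' n : ℤ × ℤ × ℤ, hx (YL n) = S + ∑' n, TfarL n := by
    rw [← hS.tsum_eq, ← hS.summable.tsum_add summable_TfarL]
    exact tsum_congr hx_eq_addL
  have hle : ∑' n, TfarL n ≤ ∑' n, BL n :=
    Summable.tsum_le_tsum (fun n => (le_abs_self _).trans (abs_TfarL_le_BL n)) summable_TfarL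
      hasSum_BL.summable
  linarith [tsum_BL_le]

/-- The lattice row of `e₁` on the squashed fcc lattice is summable (transport of
`summable_hx_YL` along the sheared labelling). [folklore] -/
theorem summable_Hrow_fccLat_sq :
    Summable (Hrow (fccLat a₀_ne_zero hSq_ne_zero_pos.1) ex₁) := by
  set L := fccLat a₀_ne_zero hSq_ne_zero_pos.1
  let φ : ℤ × ℤ × ℤ → L := fun n => ⟨YL n, YL_mem n⟩
  have hφ : Function.Injective φ := fun n n' h =>
    YL_injective (congrArg (fun y : L => (y : E3)) h)
  have hrange : ∀ y : L, y ∉ Set.range φ → Hrow L ex₁ y = 0 := by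
    intro y hy
    obtain ⟨n, hn⟩ := exists_YL_eq y.2
    exact (hy ⟨n, Subtype.ext hn⟩).elim
  have hcomp : Hrow L ex₁ ∘ φ = fun n => hx (YL n) := by
    funext n
    simp only [Function.comp, Hrow, hx, φ, Submodule.mk_eq_zero]
  exact (hφ.summable_iff hrange).1 (hcomp ▸ summable_hx_YL)

/-- Reindexing the lattice row sum by sheared labels. [folklore] -/
theorem tsum_Hrow_fccLat_sq_eq :
    ∑' y : fccLat a₀_ne_zero hSq_ne_zero_pos.1, Hrow (fccLat a₀_ne_zero hSq_ne_zero_pos.1) ex₁ y =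
      ∑' n : ℤ × ℤ × ℤ, hx (YL n) := by
  set L := fccLat a₀_ne_zero hSq_ne_zero_pos.1
  let φ : ℤ × ℤ × ℤ → L := fun n => ⟨YL n, YL_mem n⟩
  have hφ : Function.Injective φ := fun n n' h =>
    YL_injective (congrArg (fun y : L => (y : E3)) h)
  have hsupp : Function.support (Hrow L ex₁) ⊆ Set.range φ := by
    intro y _
    obtain ⟨n, hn⟩ := exists_YL_eq y.2
    exact ⟨n, Subtype.ext hn⟩
  rw [← hφ.tsum_eq hsupp]
  refine tsum_congr fun n => ?_
  simp only [Hrow, hx, φ, Submodule.mk_eq_zero]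

/-- **The lower height bound is load-bearing.**  On the window `47/50 ≤ a ≤ 1 ∧ IsHaggSeq s ∧
0 < z(m+1) − z(m) ≤ 17a/20` (the crux's `Box` with the LOWER bound `39a/50 ≤ z(m+1) − z(m)`
deleted, keeping strictly increasing heights) uniform polytype stability FAILS: the fcc word at
`a = 47/50` with uniform SQUASHED spacing `h = 1/10` is in the window and force balanced (a
Bravais lattice, part I), and its third-neighbour layers — same registry `A` — sit straight above
each other at distance `3h = 0.3`; for `u = e₁·𝟙_{0}` these two bonds contribute the tangential
prestress `2V′(3h)/(3h) ≈ −5·10⁸` to `½·hessForm = Σ_{y≠0} e₁ᵀK(y)e₁`, against `≈ +3·10⁶` from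
everything else (near block of 474 vectors exact over `ℚ` by the kernel: `< −4·10⁷` in the file's
`V/12` units; far field `|T| ≤ 8q⁻⁴ ≤` three slab majorants in SHEARED labels
`(i, j, m) ↦ i u + j v + l(m) w + m h e₃`, `l(m) ∈ {−1,0,1}`, summed with `ζ(2)`, `ζ(4)`:
`≤ 10⁶`), so `½·hessForm < 0 ≤ κ·nnForm`.  (The disprover's Bloch scan shows the statement is
in fact false already at `h = 0.66a` through an EXTENDED shear mode; the single-site witness needs
`h ≲ 0.15`.) [folklore] -/
theorem uniformPolytypeStability_false_without_heightLower :
    ¬ UniformPolytypeStabilityOn fun a s z => 47 / 50 ≤ a ∧ a ≤ 1 ∧ IsHaggSeq s ∧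
      ∀ m : ℤ, 0 < z (m + 1) - z m ∧ z (m + 1) - z m ≤ 17 / 20 * a := by
  rintro ⟨κ, hκ, h⟩
  set L := fccLat a₀_ne_zero hSq_ne_zero_pos.1
  have hS : Sites a₀ constHagg (zU hSq) = (L : Set E3) := sites_const_zU a₀_ne_zero hSq_ne_zero_pos.1
  have hW : 47 / 50 ≤ a₀ ∧ a₀ ≤ 1 ∧ IsHaggSeq constHagg ∧
      ∀ m : ℤ, 0 < zU hSq (m + 1) - zU hSq m ∧ zU hSq (m + 1) - zU hSq m ≤ 17 / 20 * a₀ := by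
    refine ⟨by unfold a₀; norm_num, by unfold a₀; norm_num, isHaggSeq_const, fun m => ?_⟩
    rw [zU_succ_sub]; unfold hSq a₀; norm_num
  have hF : ForceBalanced a₀ constHagg (zU hSq) :=
    forceBalanced_of_sites_eq L (finrank_fccLat _ _) hS
  have hsupp : Function.support (uS ex₁) ⊆ Sites a₀ constHagg (zU hSq) :=
    (support_uS ex₁).trans (by
      intro p hp
      rw [Set.mem_singleton_iff] at hp
      subst hp
      rw [hS]
      exact L.zero_mem)
  have key := h a₀ constHagg (zU hSq) hW hF (uS ex₁) (finite_support_uS ex₁) hsupp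
  rw [hessForm_single_of_summable L hS summable_Hrow_fccLat_sq, tsum_Hrow_fccLat_sq_eq] at key
  have hnn := mul_nonneg hκ.le (nnForm_nonneg a₀ constHagg (zU hSq) (uS ex₁))
  linarith [tsum_hx_YL_neg]

end HeightLower

end Summit.AtomisticToContinuum.Crystallization.Theorems.UniformPolytypeStabilityNegative

end
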